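import Mathlib
import Summits.KontsevichZagierPeriods.Zeta5Search.Elimination.ContiguousPartners
import Summits.KontsevichZagierPeriods.Zeta5Search.CasoratianValuation
import HarnessLib

/-!
# ζ(5) search — class `elim`: E0's minors ARE the valuation programme's minors; partner-independence on the
# Brown–Zudilin polytope (cell `pub-zeta5`, fam-elim, E-L10 add-on = E-L11)

HONEST FRAMING: systematic search; no irrationality claim unless certified.

OUR work (Summit side; `families/elim/FAMILY.md` §17.8–§17.9).  `Elimination/ContiguousPartners.lean` (E-L10,
filed as the lane-renamed gen-8 file: eliminant `partnerElim`, minors `Elimination.minorQ / minorPhat / minorP`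
over the up-partner `Elimination.up b i = b + e_{i+1}`) and the census's `CasoratianValuation.lean` (the OBSERVED
laws (QV), (P̂V), (CV) over `CasoratianValuation.shift b j = b + e_j` and `CasoratianValuation.minorQ / minorPhat /
casoratian`) name the SAME three rational numbers.  This add-on records the identifications (all `rfl`: one object,
two names, now linked in the tree) and transports E-L10's partner-independence to the census's objects:

* `up_eq_shift`, `minorQ_eq_cv`, `minorPhat_eq_cv`, `minorP_eq_casoratian` — definitional identifications
  (`Elimination.minorP b i = CasoratianValuation.casoratian b (i+1)` etc.);
* `partnerElim_eq_cv` — the E0 eliminant `W(b+e_{i+1})F̃₇(b) − W(b)F̃₇(b+e_{i+1})` equals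
  `CasoratianValuation.minorQ b (i+1) · ζ(5) − CasoratianValuation.casoratian b (i+1)`;
* `cv_minors_partner_independent` — for `b` in the box with `d(b) ≥ 0` and admissible slots `i, k`
  (`b_{i+1}, b_{k+1} ≤ b₀`) the census's three minors in the directions `e_{i+1}`, `e_{k+1}` coincide;
* `cv_minors_partner_independent_of_inPolytope` — on `CasoratianValuation.InPolytope b` EVERY two directions
  `e_j, e_l` (`j, l ∈ [1,7]`) give the same `minorQ`, `minorPhat`, `casoratian` (no shifted point needs to lie in the
  polytope): the laws (QV), (P̂V), (CV), quantified in `CasoratianValuation.lean` over the direction `j`, concern ONE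
  rational number per base point each — for a fixed base point, the law in one admissible direction is the law in all
  of them.

What this is NOT: anything about sizes, denominators, valuations or irrationality — bookkeeping that makes "one
definition per object" true across the elimination files and the valuation files.
-/

noncomputable section

open Finset

namespace Summit.KontsevichZagierPeriods.Zeta5Search.Elimination

open Summit.KontsevichZagierPeriods.Zeta5Search.DualSeries (InBox)
open Summit.KontsevichZagierPeriods.Zeta5Search.WedgeDictionary (coeffU coeffW coeffV dOf)
open Literature.NumberTheory.Transcendental (zetaValue)

/-! ### One object, two names -/

/-- The up-partner of E-L10 is the census's contiguous shift: `up b i = shift b (i+1)`. -/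
theorem up_eq_shift (b : ℕ → ℤ) (i : ℕ) : up b i = CasoratianValuation.shift b (i + 1) := rfl

/-- `Elimination.minorQ b i = CasoratianValuation.minorQ b (i+1)` (`U W′ − U′ W`). -/
theorem minorQ_eq_cv (b : ℕ → ℤ) (i : ℕ) : minorQ b i = CasoratianValuation.minorQ b (i + 1) := rfl

/-- `Elimination.minorPhat b i = CasoratianValuation.minorPhat b (i+1)` (`U V′ − U′ V`). -/
theorem minorPhat_eq_cv (b : ℕ → ℤ) (i : ℕ) : minorPhat b i = CasoratianValuation.minorPhat b (i + 1) := rfl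

/-- `Elimination.minorP b i = CasoratianValuation.casoratian b (i+1)` (`W′ V − W V′`): the constant term of the E0
eliminant is the census's Casoratian. -/
theorem minorP_eq_casoratian (b : ℕ → ℤ) (i : ℕ) :
    minorP b i = CasoratianValuation.casoratian b (i + 1) := rfl

/-- The E0 eliminant over the census's objects:
`W(b+e_{i+1})·F̃₇(b) − W(b)·F̃₇(b+e_{i+1}) = minorQ b (i+1) · ζ(5) − casoratian b (i+1)`. -/
theorem partnerElim_eq_cv (b : ℕ → ℤ) (hb : InBox b) (hd : 0 ≤ dOf b) {i : ℕ} (hi : i ∈ range 7)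
    (hli : b (i + 1) ≤ b 0) :
    partnerElim b i = (CasoratianValuation.minorQ b (i + 1) : ℝ) * zetaValue 5
      - (CasoratianValuation.casoratian b (i + 1) : ℝ) := by
  rw [partnerElim_eq b hb hd hi hli, minorQ_eq_cv, minorP_eq_casoratian]

/-! ### Partner-independence, transported to the census's minors -/

/-- For `b` in the box with `d(b) ≥ 0` and admissible slots `i, k < 7` (`b_{i+1}, b_{k+1} ≤ b₀`), the census's three
minors in the directions `e_{i+1}` and `e_{k+1}` coincide (E-L10's `minorQ/minorPhat/minorP_partner_independent`). -/
theorem cv_minors_partner_independent (b : ℕ → ℤ) (hb : InBox b) (hd : 0 ≤ dOf b) {i k : ℕ}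
    (hi : i ∈ range 7) (hk : k ∈ range 7) (hli : b (i + 1) ≤ b 0) (hlk : b (k + 1) ≤ b 0) :
    CasoratianValuation.minorQ b (i + 1) = CasoratianValuation.minorQ b (k + 1) ∧
      CasoratianValuation.minorPhat b (i + 1) = CasoratianValuation.minorPhat b (k + 1) ∧
      CasoratianValuation.casoratian b (i + 1) = CasoratianValuation.casoratian b (k + 1) := by
  refine ⟨?_, ?_, ?_⟩
  · rw [← minorQ_eq_cv, ← minorQ_eq_cv]; exact minorQ_partner_independent b hb hd hi hk hli hlk
  · rw [← minorPhat_eq_cv, ← minorPhat_eq_cv]; exact minorPhat_partner_independent b hb hd hi hk hli hlk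
  · rw [← minorP_eq_casoratian, ← minorP_eq_casoratian]
    exact minorP_partner_independent b hb hd hi hk hli hlk

/-- **On the Brown–Zudilin polytope all seven directions give the same three minors.**  For
`CasoratianValuation.InPolytope b` (`InBox b`, `2b_j ≤ b₀`, `Σ b_j ≤ 3b₀`) and any `j, l ∈ [1,7]`:
`minorQ b j = minorQ b l`, `minorPhat b j = minorPhat b l`, `casoratian b j = casoratian b l` — so the laws (QV),
(P̂V), (CV) of `CasoratianValuation.lean` concern one rational number per base point each. -/
theorem cv_minors_partner_independent_of_inPolytope (b : ℕ → ℤ) (hb : CasoratianValuation.InPolytope b)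
    {j l : ℕ} (hj : j ∈ Icc 1 7) (hl : l ∈ Icc 1 7) :
    CasoratianValuation.minorQ b j = CasoratianValuation.minorQ b l ∧
      CasoratianValuation.minorPhat b j = CasoratianValuation.minorPhat b l ∧
      CasoratianValuation.casoratian b j = CasoratianValuation.casoratian b l := by
  obtain ⟨hj1, hj7⟩ := mem_Icc.1 hj
  obtain ⟨hl1, hl7⟩ := mem_Icc.1 hl
  obtain ⟨i, rfl⟩ : ∃ i, j = i + 1 := ⟨j - 1, by omega⟩
  obtain ⟨k, rfl⟩ : ∃ k, l = k + 1 := ⟨l - 1, by omega⟩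
  have hi : i ∈ range 7 := mem_range.2 (by omega)
  have hk : k ∈ range 7 := mem_range.2 (by omega)
  have hbox : InBox b := hb.1
  have hd : 0 ≤ dOf b := by have := hb.2.2; unfold dOf; linarith
  have hli : b (i + 1) ≤ b 0 := by
    have h2 := hb.2.1 i hi; have h0 := (hbox.2 i hi).1; linarith
  have hlk : b (k + 1) ≤ b 0 := by
    have h2 := hb.2.1 k hk; have h0 := (hbox.2 k hk).1; linarith
  exact cv_minors_partner_independent b hbox hd hi hk hli hlk

/-- The same, one minor at a time, in the shape the law files use (`1 ≤ j`, `j ≤ 7`): on the polytope the direction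
of (QV)/(P̂V)/(CV) may be moved to `e₁`. -/
theorem cv_minors_eq_dir_one (b : ℕ → ℤ) (hb : CasoratianValuation.InPolytope b) {j : ℕ} (hj1 : 1 ≤ j)
    (hj7 : j ≤ 7) :
    CasoratianValuation.minorQ b j = CasoratianValuation.minorQ b 1 ∧
      CasoratianValuation.minorPhat b j = CasoratianValuation.minorPhat b 1 ∧
      CasoratianValuation.casoratian b j = CasoratianValuation.casoratian b 1 :=
  cv_minors_partner_independent_of_inPolytope b hb (mem_Icc.2 ⟨hj1, hj7⟩) (mem_Icc.2 ⟨le_rfl, by norm_num⟩)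

end Summit.KontsevichZagierPeriods.Zeta5Search.Elimination

end
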